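import Summits.Ventures.PercRepro.ProfilePointedCircuitClassesSixFourteen

/-!
# PercRepro — TWO UNCONDITIONAL REGIMES OF THE TWELVE-POINT STATEMENT `InOutBottomTwelve`
(p5, gen 43; `proofs/P5-GM1.md` §65)

`InOutBottomTwelve` (ProfilePointedCircuitClassesSixFourteen) asks `in_5(e) ≤ out_6(e)` on every matroid with
`12` points and rank `7`.  Two regimes of it are theorems in the PRIMAL, with no dual and no charging:

* THE SPARSE REGIME (`inCount_five_le_outCount_six_of_twelve_of_sparse`): if every `8`-subset of the ground set
  has rank `≥ 6` (in the dual: no four points of rank `≤ 2`, i.e. no `4`-point line, no parallel class of three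
  points, no two coplanar parallel pairs), then every DEMAND (a bi-independent `5`-set `W ∋ e`) has at least `5`
  UNITS (bi-independent `6`-sets `S ∌ e`) disjoint from it — `S = B − b` for `b` in the basis `B = E ∖ W` with
  `W + b` independent, and at most two points of `B` lie in `cl W` — while every unit has at most `5` demands
  disjoint from it (`W = (E ∖ S) − t`, `t ≠ e`); the disjointness relation is counted from both sides
  (`Finset.sum_card_bipartiteAbove_eq_sum_card_bipartiteBelow`).  The hypothesis is exactly «no deficient demand»
  (§63(c)): the whole difficulty of the twelve-point statement sits in the demands whose basis complement has three
  or four coloops in the dual.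

* THE RATIO REGIME (`inCount_five_le_outCount_six_of_twelve_of_ratio`): if `5·in_5(e) ≤ 7·out_5(e)` — the point
  `e` lies in at most `7/12` of the bi-independent `5`-sets — then Theorem A's level-5 step on twelve points
  (`biIndep_step_five_of_nullity_five`, unconditional since §61) gives the claim through the complementation
  identity `in_6(e) = out_6(e)` (`inCount_six_eq_outCount_six_of_twelve`).  On the census the complementary
  condition `5·in_5(e) > 7·out_5(e)` holds at 8 of 11,520 random points (§65).
-/

open scoped Matroid

namespace PercRepro.Cogirth

open Finset ThmH Skew Shadow Profile

variable {α : Type} [DecidableEq α] {N : Matroid α} [N.Finite]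

section TwelveSparse

/-- The units disjoint from a demand are the sets `(E ∖ W) − b` with `W + b` independent: for a bi-independent
`5`-set `W ∋ e` of a matroid with `12` points and rank `7`, and a point `b ∉ W` with `rk (W + b) = 6`, the set
`(E ∖ W) − b` is a bi-independent `6`-set avoiding `e` and disjoint from `W`. -/
theorem sdiff_erase_mem_units_of_rk_insert_eq_six (hn : (gr N).card = 12) {e : α} {W : Finset α}
    (hW : W ∈ (biIndepSets N 5).filter (fun X => e ∈ X)) {b : α} (hb : b ∈ gr N \ W)
    (hrk : rk N (insert b W) = 6) :
    (gr N \ W).erase b ∈ ((biIndepSets N 6).filter (fun X => e ∉ X)).filter (fun S => W ∩ S = ∅) := by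
  rw [mem_filter, mem_biIndepSets] at hW
  obtain ⟨⟨hWg, hW5, hWr, hWc⟩, heW⟩ := hW
  rw [mem_sdiff] at hb
  have hB7 : (gr N \ W).card = 7 := by rw [card_sdiff_of_subset hWg, hn, hW5]
  have hcompl : gr N \ (gr N \ W).erase b = insert b W := by
    ext x
    simp only [mem_sdiff, mem_erase, mem_insert, not_and, not_not]
    constructor
    · rintro ⟨hxg, h⟩
      by_cases hxb : x = b
      · exact Or.inl hxb
      · exact Or.inr (h hxb hxg)
    · rintro (rfl | hxW)
      · exact ⟨hb.1, fun h _ => absurd rfl h⟩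
      · exact ⟨hWg hxW, fun _ _ => hxW⟩
  rw [mem_filter, mem_filter, mem_biIndepSets]
  refine ⟨⟨⟨(erase_subset b _).trans sdiff_subset, ?_, ?_, ?_⟩, ?_⟩, ?_⟩
  · rw [card_erase_of_mem (mem_sdiff.2 hb), hB7]
  · exact rk_eq_card_of_subset_of_rk_eq_card (erase_subset b _) (by rw [hWc])
  · rw [hcompl, hrk, card_insert_of_notMem hb.2, hW5]
  · intro he
    exact (mem_sdiff.1 (mem_of_mem_erase he)).2 heW
  · ext x
    simp only [mem_inter, mem_erase, mem_sdiff, notMem_empty, iff_false, not_and]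
    intro hxW _ hxg hxnW
    exact hxnW hxW

/-- **THE DEMANDS' SIDE IN THE SPARSE REGIME**: if every `8`-subset of `E` has rank `≥ 6` (`#E = 12`, `ρ = 7`), a
bi-independent `5`-set `W ∋ e` has at least five bi-independent `6`-sets avoiding `e` and disjoint from it. -/
theorem five_le_card_units_of_sparse (hn : (gr N).card = 12)
    (h8 : ∀ X ⊆ gr N, X.card = 8 → 6 ≤ rk N X) {e : α} {W : Finset α}
    (hW : W ∈ (biIndepSets N 5).filter (fun X => e ∈ X)) :
    5 ≤ (((biIndepSets N 6).filter (fun X => e ∉ X)).filter (fun S => W ∩ S = ∅)).card := by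
  have hW' := hW
  rw [mem_filter, mem_biIndepSets] at hW'
  obtain ⟨⟨hWg, hW5, hWr, hWc⟩, heW⟩ := hW'
  have hB7 : (gr N \ W).card = 7 := by rw [card_sdiff_of_subset hWg, hn, hW5]
  -- the good points of `B`: those with `rk (W + b) = 6`
  set G := (gr N \ W).filter (fun b => rk N (insert b W) = 6) with hG
  -- every other point of `B` lies in `cl W`, and there are at most two of them
  have hbad : ((gr N \ W).filter (fun b => ¬ rk N (insert b W) = 6)).card ≤ 2 := by
    by_contra hcon
    rw [not_le] at hcon
    obtain ⟨T, hTsub, hT3⟩ :=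
      exists_subset_card_eq (s := (gr N \ W).filter (fun b => ¬ rk N (insert b W) = 6)) (n := 3) (by omega)
    have hTB : T ⊆ gr N \ W := hTsub.trans (filter_subset _ _)
    have hTcl : T ⊆ clF N W := by
      intro t ht
      have ht' := hTsub ht
      rw [mem_filter, mem_sdiff] at ht'
      have hle := rk_insert_le t W (M := N)
      have hge : rk N W ≤ rk N (insert t W) := rk_mono' (subset_insert t W)
      rw [mem_clF_iff_rk_insert_eq ht'.1.1 hWg]
      omega
    have hXcl : W ∪ T ⊆ clF N W := union_subset (subset_clF hWg) hTcl
    have hXr : rk N (W ∪ T) ≤ 5 := by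
      have := rk_le_rk_of_subset_clF hXcl
      omega
    have hdisj : Disjoint W T := by
      rw [disjoint_left]
      intro x hxW hxT
      exact (mem_sdiff.1 (hTB hxT)).2 hxW
    have hX8 : (W ∪ T).card = 8 := by rw [card_union_of_disjoint hdisj, hW5, hT3]
    have hXg : W ∪ T ⊆ gr N := union_subset hWg (hTB.trans sdiff_subset)
    have := h8 (W ∪ T) hXg hX8
    omega
  have hG5 : 5 ≤ G.card := by
    rw [hG]
    have := card_filter_add_card_filter_not (s := gr N \ W) (fun b => rk N (insert b W) = 6)
    rw [hB7] at this
    omega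
  -- the injection `b ↦ B − b` into the units disjoint from `W`
  calc 5 ≤ G.card := hG5
    _ = (G.image (fun b => (gr N \ W).erase b)).card := by
        rw [card_image_of_injOn]
        intro b hb b' hb' hbb'
        have hbB : b ∈ gr N \ W := (mem_filter.1 hb).1
        have hbb'' : (gr N \ W).erase b = (gr N \ W).erase b' := hbb'
        by_contra hne
        have : b ∈ (gr N \ W).erase b' := mem_erase.2 ⟨hne, hbB⟩
        rw [← hbb''] at this
        exact (mem_erase.1 this).1 rfl
    _ ≤ _ := by
        apply card_le_card
        intro S hS
        rw [mem_image] at hS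
        obtain ⟨b, hb, rfl⟩ := hS
        rw [hG, mem_filter] at hb
        exact sdiff_erase_mem_units_of_rk_insert_eq_six hn hW hb.1 hb.2

/-- **THE UNITS' SIDE**: a bi-independent `6`-set `S ∌ e` of a matroid with `12` points has at most five
bi-independent `5`-sets `W ∋ e` disjoint from it (they are the sets `(E ∖ S) − t`, `t ≠ e`). -/
theorem card_demands_le_five (hn : (gr N).card = 12) {e : α} {S : Finset α}
    (hS : S ∈ (biIndepSets N 6).filter (fun X => e ∉ X)) :
    (((biIndepSets N 5).filter (fun X => e ∈ X)).filter (fun W => W ∩ S = ∅)).card ≤ 5 := by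
  rw [mem_filter, mem_biIndepSets] at hS
  obtain ⟨⟨hSg, hS6, _, _⟩, heS⟩ := hS
  have hZ6 : (gr N \ S).card = 6 := by rw [card_sdiff_of_subset hSg, hn, hS6]
  -- a demand disjoint from `S` lies inside `E ∖ S`
  have hWZ : ∀ W ∈ ((biIndepSets N 5).filter (fun X => e ∈ X)).filter (fun W => W ∩ S = ∅),
      W ⊆ gr N \ S := by
    intro W hW
    rw [mem_filter, mem_filter, mem_biIndepSets] at hW
    obtain ⟨⟨⟨hWg, _, _, _⟩, _⟩, hWS⟩ := hW
    intro w hw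
    rw [mem_sdiff]
    refine ⟨hWg hw, fun hwS => ?_⟩
    have : w ∈ W ∩ S := mem_inter.2 ⟨hw, hwS⟩
    rw [hWS] at this
    exact notMem_empty w this
  by_cases he : e ∈ gr N \ S
  · -- every such demand is `(E ∖ S) − t` for a point `t ≠ e` of `E ∖ S`
    have hsub : ((biIndepSets N 5).filter (fun X => e ∈ X)).filter (fun W => W ∩ S = ∅) ⊆
        ((gr N \ S).erase e).image (fun t => (gr N \ S).erase t) := by
      intro W hW
      have hWZ' := hWZ W hW
      rw [mem_filter, mem_filter, mem_biIndepSets] at hW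
      obtain ⟨⟨⟨_, hW5, _, _⟩, heW⟩, _⟩ := hW
      have h1 : ((gr N \ S) \ W).card = 1 := by rw [card_sdiff_of_subset hWZ', hZ6, hW5]
      obtain ⟨t, ht⟩ := card_eq_one.1 h1
      have htmem : t ∈ (gr N \ S) \ W := by rw [ht]; exact mem_singleton_self t
      rw [mem_sdiff] at htmem
      rw [mem_image]
      refine ⟨t, mem_erase.2 ⟨fun h => htmem.2 (h ▸ heW), htmem.1⟩, (Finset.eq_of_subset_of_card_le ?_ ?_).symm⟩
      · intro w hw
        rw [mem_erase]
        exact ⟨fun h => htmem.2 (h ▸ hw), hWZ' hw⟩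
      · rw [card_erase_of_mem htmem.1, hZ6, hW5]
    calc _ ≤ (((gr N \ S).erase e).image (fun t => (gr N \ S).erase t)).card := card_le_card hsub
      _ ≤ ((gr N \ S).erase e).card := card_image_le
      _ = 5 := by rw [card_erase_of_mem he, hZ6]
  · -- no demand at all: `e ∈ W ⊆ E ∖ S` would put `e` in `E ∖ S`
    have : ((biIndepSets N 5).filter (fun X => e ∈ X)).filter (fun W => W ∩ S = ∅) = ∅ := by
      rw [eq_empty_iff_forall_notMem]
      intro W hW
      have hWZ' := hWZ W hW
      rw [mem_filter, mem_filter] at hW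
      exact he (hWZ' hW.1.2)
    rw [this, card_empty]
    exact Nat.zero_le 5

/-- **THE SPARSE REGIME OF `InOutBottomTwelve`**: on a matroid with `12` points and rank `7` in which every
`8`-subset of the ground set has rank `≥ 6`, `in_5(e) ≤ out_6(e)` at every point `e` — the disjointness relation
between demands and units counted from both sides. -/
theorem inCount_five_le_outCount_six_of_twelve_of_sparse (hn : (gr N).card = 12)
    (h8 : ∀ X ⊆ gr N, X.card = 8 → 6 ≤ rk N X) (e : α) : inCount N 5 e ≤ outCount N 6 e := by
  unfold inCount outCount
  set D := (biIndepSets N 5).filter (fun X => e ∈ X) with hD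
  set U := (biIndepSets N 6).filter (fun X => e ∉ X) with hU
  have key := Finset.sum_card_bipartiteAbove_eq_sum_card_bipartiteBelow (fun W S => W ∩ S = ∅)
    (s := D) (t := U)
  have h1 : 5 * D.card ≤ ∑ W ∈ D, (Finset.bipartiteAbove (fun W S => W ∩ S = ∅) U W).card := by
    rw [mul_comm, ← smul_eq_mul]
    apply card_nsmul_le_sum
    intro W hW
    unfold Finset.bipartiteAbove
    exact five_le_card_units_of_sparse hn h8 hW
  have h2 : ∑ S ∈ U, (Finset.bipartiteBelow (fun W S => W ∩ S = ∅) D S).card ≤ 5 * U.card := by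
    rw [mul_comm, ← smul_eq_mul]
    apply sum_le_card_nsmul
    intro S hS
    unfold Finset.bipartiteBelow
    exact card_demands_le_five hn hS
  omega

end TwelveSparse

section TwelveRatio

/-- **COMPLEMENTATION AT `n = 12`**: the bi-independent `6`-sets containing `e` and those avoiding it are
exchanged by `X ↦ E ∖ X`, so `in_6(e) = out_6(e)` for every point `e` of the ground set. -/
theorem inCount_six_eq_outCount_six_of_twelve (hn : (gr N).card = 12) {e : α} (he : e ∈ gr N) :
    inCount N 6 e = outCount N 6 e := by
  unfold inCount outCount
  apply card_nbij' (fun X => gr N \ X) (fun X => gr N \ X)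
  · intro X hX
    rw [mem_coe, mem_filter, mem_biIndepSets] at hX
    obtain ⟨⟨hXg, hX6, hXr, hXc⟩, heX⟩ := hX
    rw [mem_coe, mem_filter, mem_biIndepSets]
    refine ⟨⟨sdiff_subset, by rw [card_sdiff_of_subset hXg, hn, hX6], hXc, ?_⟩, ?_⟩
    · rw [Finset.sdiff_sdiff_eq_self hXg]; exact hXr
    · intro h
      exact (mem_sdiff.1 h).2 heX
  · intro X hX
    rw [mem_coe, mem_filter, mem_biIndepSets] at hX
    obtain ⟨⟨hXg, hX6, hXr, hXc⟩, heX⟩ := hX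
    rw [mem_coe, mem_filter, mem_biIndepSets]
    refine ⟨⟨sdiff_subset, by rw [card_sdiff_of_subset hXg, hn, hX6], hXc, ?_⟩, ?_⟩
    · rw [Finset.sdiff_sdiff_eq_self hXg]; exact hXr
    · exact mem_sdiff.2 ⟨he, heX⟩
  · intro X hX
    rw [mem_coe, mem_filter, mem_biIndepSets] at hX
    exact Finset.sdiff_sdiff_eq_self hX.1.1
  · intro X hX
    rw [mem_coe, mem_filter, mem_biIndepSets] at hX
    exact Finset.sdiff_sdiff_eq_self hX.1.1

/-- **THE RATIO REGIME OF `InOutBottomTwelve`**: on a matroid with `12` points and rank `7`, at a point `e` with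
`5·in_5(e) ≤ 7·out_5(e)`, Theorem A's level-5 step `7·P_5 ≤ 6·P_6` and the complementation `P_6 = 2·out_6(e)`
give `12·in_5(e) ≤ 7·in_5(e) + 7·out_5(e) ≤ 12·out_6(e)`. -/
theorem inCount_five_le_outCount_six_of_twelve_of_ratio (hn : (gr N).card = 12) (hR : rk N (gr N) = 7)
    {e : α} (he : e ∈ gr N) (hratio : 5 * inCount N 5 e ≤ 7 * outCount N 5 e) :
    inCount N 5 e ≤ outCount N 6 e := by
  have hstep := biIndep_step_five_of_nullity_five (N := N) (by rw [hn, hR]) (by rw [hR])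
  have h5 := inCount_add_outCount N 5 e
  have h6 := inCount_add_outCount N 6 e
  have hc := inCount_six_eq_outCount_six_of_twelve hn he
  rw [hn] at hstep
  omega

end TwelveRatio


end PercRepro.Cogirth
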